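import Literature.AlgebraicGeometry.HodgeTheory.GeneralHodgePropertyCMType
import HarnessLib

/-!
# Hazama 2003: for abelian varieties of CM-type, the Hodge conjecture IN CODIMENSION TWO already implies the whole general Hodge conjecture (hence the usual Hodge conjecture in every codimension)

Family `hodge`, layer `Literature/AlgebraicGeometry/HodgeTheory`. Written by the literature seat of the
cell `pub-hodgecm` (consequence lane, `HOME/CONSEQUENCES.md` §28) as the kernel-visible form of a printed
REDUCTION of the hypothesis `HC_CM` (= `∀ A, Milne1999.CMHodgeHypothesisAt A`, the Hodge conjecture for all
complex abelian varieties of CM-type, which is the hypothesis of Milne 1999 Thm. 7.1 and of every consequence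
edge of that lane): in print, `HC_CM` follows from its CODIMENSION-TWO case. `HC_CM` is never asserted here;
it and its codimension-two case occur only as hypotheses / sides of an equivalence.

## The source, verbatim (read first-hand, 2026-08-19)

F. Hazama, *On the General Hodge Conjecture for Abelian Varieties of CM-type*, Publ. RIMS Kyoto Univ. **39**
(2003) 625–655 [Hazama2003GHCCM] (DOI 10.2977/prims/1145476042; open access at EMS Press, file
`https://ems.press/content/serial-article-files/40835` — `lit read '<that URL>'` writes the 31 page files
in any session, page file `pNNNN` = journal page `624 + N`, Thm. 8.3 on `p0031` L10–L12; read again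
first-hand 2026-08-19T22:45Z, identical bytes), the full version of the announcement F. Hazama, *General
Hodge conjecture for abelian varieties of CM-type*, Proc. Japan Acad. **78A** (2002) 72–75 [Hazama2002GHCCM]
(DOI 10.3792/pjaa.78.72; open access at Project Euclid, file
`https://projecteuclid.org/journals/proceedings-of-the-japan-academy-series-a-mathematical-sciences/volume-78/issue-6/General-Hodge-conjecture-for-abelian-varieties-of-CM-type/10.3792/pjaa.78.72.pdf`,
4 page files = pp. 72–75). (The keys `paper:url-…` printed by `lit read <url>` are session-private cache
keys, not shared-store keys; shared-store ingest of both files is acquisition request acq-08458 /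
acq-08459.)

* Abstract (p. 625): "The General Hodge Conjecture for abelian varieties of CM-type is shown to be implied
  by the usual Hodge Conjecture for those up to codimension two."  §1 (p. 625): "The purpose of this
  article is to show that the validity of the Hodge Conjecture in codimension two implies that of the whole
  General Hodge Conjecture (GHC for short) for any abelian varieties of CM-type."
* §2 (p. 627), Grothendieck's amended general Hodge conjecture: "(2.1) `GHC(p, k, X)`:
  `F^p_a H^k(X, ℚ) = F^p_h H^k(X, ℚ)`" (`F_a` the arithmetic filtration, `F^p_h H^k(X, ℚ)` "the largest
  rational sub-Hodge structure in `F^p H^k(X, ℂ) ∩ H^k(X, ℚ)`"), equivalently "(2.2) For any rational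
  sub-Hodge structure `W ⊂ H^k(X, ℚ)` with `ℓ(W) = k − 2p`, there exists a Zariski-closed subset `Z` of
  codimension `p` on `X` such that `W ⊂ ker{H^k(X, ℚ) → H^k(X − Z, ℚ)}`."  "Lemma 2.1. Let `A` be an
  abelian variety and `B` an abelian subvariety of `A`. Then GHC for `A` implies that for `B`." (proof:
  "One can easily check that if GHC holds for an abelian variety, then it also holds for any abelian
  variety isogenous to it. Hence by Poincare reducibility …").
* (4.B) (p. 631): for a Galois CM-field `K`, `Gal(K/ℚ) ≅ G`, "A finite right `G`-set `S`, plus the data of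
  `S₁ ⊂ S` with `S` the disjoint sum of `S₁` and `S₁ρ`, give an abelian variety `A` of CM type (up to
  isogeny) […] `A` is `ℂ^{S₁}/{a lattice in F}`"; (4.3) (p. 634): "`A` of CM-type is said to be
  `N`-dominated if for every `n ≥ 1` the Hodge ring `H(Aⁿ)_ℂ` of `Aⁿ` is spanned by the Hodge classes
  `[P]`, `P ⊂ S(n)` with `#(P) ≤ 2N`."
* §5–§6: the hyperplane arrangement `A(2ⁿ)` of the `n` coordinate hyperplanes of `ℝⁿ` ("of
  `(2, …, 2)`-type", `#R(A(2ⁿ)) = 2ⁿ` regions, p. 639) is a CM-arrangement for every pair `(G, K)`, `K` a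
  Galois CM-field of degree `2n` (Prop. 6.1, p. 643), whence the CM abelian variety `A_{A(2ⁿ)}(G; K)`
  (`S = R(A(2ⁿ))`, `S₁ = H₁⁺`, p. 636); "Proposition 6.5. Any abelian variety split by `K` is realized up
  to isogeny as an abelian subvariety of a certain self-product `A_{A(2ⁿ)}(G; K)^m` for suitable `m ≥ 1`."
  (p. 644); "Theorem 7.14. […] When `n ≥ 3`, the abelian variety `A_{A(2ⁿ)}(G; K)` is 1-degenerate and
  2-dominated." (p. 650).
* §8: "Theorem 8.2. Suppose that the Hodge cycles of codimension two on `A_{A(2ⁿ)}(G; K)` is algebraic.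
  Then the whole GHC holds for `A_{A(2ⁿ)}(G; K)`." (p. 651); "Corollary (of the proof). […] Then the whole
  GHC holds for any self-product `A_{A(2ⁿ)}(G; K)^m`." (p. 654); and, "combining this corollary with
  Proposition 6.5 and Lemma 2.1" (p. 654): "**Theorem 8.3.** Suppose that any Hodge cycle of codimension
  two on `A_{A(2ⁿ)}(G; K)` is algebraic for any pair `(G, K)`. Then the whole GHC holds for any abelian
  variety of CM-type." (p. 655) (= Thm. 7.6 of the 2002 announcement, p. 75).

Independent printed witness of the weaker form "usual HC for all CM abelian varieties ⟹ GHC for them":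
S. Abdulali, J. Ramanujan Math. Soc. 20 (2005), Introduction and Thm. 4 — the tree's record
`Abdulali2005_generalHodge_cmType_of_hodge_cmType` (`HodgeTheory/GeneralHodgePropertyCMType`), which this
file's record IMPLIES (`abdulali2005_of_hazama2003`, proved).

## Lean rendering

* `CMHodgeCodimTwoHypothesisAt B` — "every Hodge cycle of codimension two on `B` is algebraic", at one
  complex abelian variety of CM-type: the `p = 2` clause of the tree's REAL per-variety statement
  `HodgeConjectureFor` (rational classes of Hodge type `(2,2)` in `H⁴(B(ℂ); ℂ)` lie in
  `algebraicClasses B.X 2 = N² H⁴`), guarded exactly like `Milne1999.CMHodgeHypothesisAt B` (smooth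
  projective — a theorem, `AbelianVariety.isSmoothProjective_holds` — and `Milne1999.IsOfCMType B`). A
  PREDICATE on `B`; nothing is asserted.
* The NAMED FACT `Hazama2003_generalHodge_cmType_of_hodge_codimTwo :
  (∀ B, CMHodgeCodimTwoHypothesisAt B) → ∀ A, CMGeneralHodgeHypothesisAt A` — the Abstract / §1 sentence,
  which is Theorem 8.3 with its hypothesis STRENGTHENED from "codimension-two Hodge cycles on the abelian
  varieties `A_{A(2ⁿ)}(G; K)`, all pairs `(G, K)`" to "codimension-two Hodge cycles on all CM abelian
  varieties" (each `A_{A(2ⁿ)}(G; K)` is a CM abelian variety, (4.B)) — so the vendored IMPLICATION is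
  WEAKER than Theorem 8.3 as printed, the safe direction (wording corrected 2026-08-20 after referee
  mc-ref R-10, W-R10.1); conclusion = the tree's `GHC_CM`
  predicate `CMGeneralHodgeHypothesisAt` of `GeneralHodgePropertyCMType` (Grothendieck's amended `GHC(X, i, r)`
  on the real carriers, all `i, r`; Hazama's (2.1)/(2.2) is that statement, §2 p. 627 = Grothendieck 1969
  p. 300). A THEOREM in print, vendored as a named fact: the tree has neither the CM abelian variety of a
  CM-arrangement (§5) nor the Hodge-ring combinatorics (§§3–4, 7) of the proof.
  -- TODO(general form): Theorem 8.3 as printed needs the codimension-two classes on the countable family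
  -- `A_{A(2ⁿ)}(G; K)` only (dimension `2^{n-1}`, `K` Galois CM of degree `2n` with `G = Gal(K/ℚ)` acting
  -- on `A(2ⁿ)` through Prop. 6.1); typing that family needs Hazama's §5 construction.
* PROVED bookkeeping: `CMHodgeHypothesisAt.codimTwo` (the codimension-two case of (H) at `B`);
  `cmHodgeHypothesisAt_of_codimTwo` (granted the record, the codimension-two case for all CM abelian
  varieties gives Milne's hypothesis (H) at every `A` — through the tree's UNCONDITIONAL
  `CMGeneralHodgeHypothesisAt.cmHodgeHypothesisAt`, Grothendieck 1969 p. 301: `GHC(X, 2p, p)` is the usual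
  Hodge conjecture); `cmHodgeHypothesis_iff_codimTwo` (so, granted the record, `HC_CM` is EQUIVALENT to its
  codimension-two case); `abdulali2005_of_hazama2003`; and the composite with Milne 1999 Thm. 7.1,
  `Milne1999.tateAV_Fq_of_hodge_codimTwo_cmType` (Tate's (0.1) for every abelian variety over every finite
  field from Milne's theorem at the intended `E`, Hazama's theorem, and codimension-two Hodge classes on
  complex CM abelian varieties).

## References

* [Hazama2003GHCCM] F. Hazama, Publ. RIMS 39 (2003) 625–655: Abstract, §1 p. 625; §2 (2.1)/(2.2), Lemma 2.1
  p. 627; (4.B) p. 631; (4.3)/(4.4), Prop. 4.4, Cor. 4.4.1 pp. 634–635; §5 p. 636, p. 639; Prop. 6.1 p. 643,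
  Prop. 6.5 p. 644; Thm. 7.14, Cor. 7.14.1 p. 650; Thm. 8.2 p. 651, Corollary p. 654, Thm. 8.3 p. 655.
* [Hazama2002GHCCM] F. Hazama, Proc. Japan Acad. 78A (2002) 72–75: Abstract, Thm. 7.4, Cor. 7.4.1, Thms. 7.5,
  7.6 p. 75.
* [Abdulali2005CMHodge] S. Abdulali, J. Ramanujan Math. Soc. 20 (2005), Introduction, §3 Thm. 4.
* [GrothendieckTopology1969] A. Grothendieck, Topology 8 (1969), p. 301.
* [Milne1999] J. S. Milne, Compositio Math. 117 (1999), Thm. 7.1 p. 72.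
-/

noncomputable section

namespace Literature.AlgebraicGeometry.HodgeTheory

/-! ### The Hodge conjecture in codimension two, at one CM abelian variety -/

/-- **"Every Hodge cycle of codimension two on `B` is algebraic"** (Hazama's hypothesis, at one complex
abelian variety `B` of CM-type): if `B` is (smooth projective and) of CM-type (`Milne1999.IsOfCMType`), every
rational class of Hodge type `(2, 2)` in `H⁴(B(ℂ); ℂ)` lies in `algebraicClasses B.X 2` — the `p = 2` clause
of the tree's real per-variety statement (the one the summit `Statement.lean` quantifies), guarded exactly as
`Milne1999.CMHodgeHypothesisAt B`, of which it is the codimension-two case (`CMHodgeHypothesisAt.codimTwo`).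
A PREDICATE on `B` (a definition; nothing is asserted; the printed sentences are quoted verbatim in the
module docstring). [cite: Hazama2003GHCCM, §1 p. 625 and Thm. 8.3 p. 655] -/
def CMHodgeCodimTwoHypothesisAt (B : Motives.AbelianVariety ℂ) : Prop :=
  Motives.IsSmoothProjective B.dim B.X → Milne1999.IsOfCMType B →
    ∀ c : Literature.AlgebraicTopology.SingularHomology.singularCohomology ℂ ℂ
        (Motives.ComplexPoints B.X) (2 * 2),
      IsRationalClass c → IsOfHodgeType B.dim B.X (2 * 2) 2 2 c → c ∈ algebraicClasses B.X 2

/-- Unfolding of `CMHodgeCodimTwoHypothesisAt`. [cite: Hazama2003GHCCM, Thm. 8.3 p. 655] -/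
theorem cmHodgeCodimTwoHypothesisAt_iff (B : Motives.AbelianVariety ℂ) :
    CMHodgeCodimTwoHypothesisAt B ↔
      (Motives.IsSmoothProjective B.dim B.X → Milne1999.IsOfCMType B →
        ∀ c : Literature.AlgebraicTopology.SingularHomology.singularCohomology ℂ ℂ
            (Motives.ComplexPoints B.X) (2 * 2),
          IsRationalClass c → IsOfHodgeType B.dim B.X (2 * 2) 2 2 c → c ∈ algebraicClasses B.X 2) :=
  Iff.rfl

/-- The codimension-two case of Milne's hypothesis (H) at `B` (unconditional bookkeeping: (H) at `B` says that
the Hodge classes on `B` of every codimension are algebraic). [cite: Milne1999, Thm. 7.1 p. 72] -/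
theorem _root_.Literature.AlgebraicGeometry.Milne1999.CMHodgeHypothesisAt.codimTwo
    {B : Motives.AbelianVariety ℂ} (h : Milne1999.CMHodgeHypothesisAt B) :
    CMHodgeCodimTwoHypothesisAt B :=
  fun hB hCM c hc hpp ↦ (h hB hCM).2 2 c hc hpp

/-! ### Hazama's theorem -/

/-- **Hazama 2003, a THEOREM in print: for abelian varieties of CM-type, algebraicity of the Hodge cycles
of codimension two already gives Grothendieck's amended `GHC` in every degree and coniveau.** Abstract
(p. 625) and §1 (p. 625), quoted verbatim in the module docstring ("… is shown to be implied by the usual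
Hodge [statement] for those up to codimension two"; "the validity of the Hodge [statement] in codimension
two implies that of the whole [GHC] for any abelian varieties of CM-type"); this is Theorem 8.3 (p. 655:
"Suppose that any Hodge cycle of codimension two on `A_{A(2ⁿ)}(G; K)` is algebraic for any pair `(G, K)`.
Then the whole GHC holds for any abelian variety of CM-type.") with the hypothesis strengthened from the CM
abelian varieties `A_{A(2ⁿ)}(G; K)` of the `(2,…,2)`-arrangements to all CM abelian varieties (hence an
implication weaker than Theorem 8.3 as printed — the safe direction). Rendered with
the hypothesis `∀ B, CMHodgeCodimTwoHypothesisAt B` and the conclusion `∀ A, CMGeneralHodgeHypothesisAt A`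
(the tree's `GHC_CM` predicate of `GeneralHodgePropertyCMType`; Hazama's (2.1) is Grothendieck's amended
statement). PROVED in print (Publ. RIMS 39 (2003) §§2–8; announced Proc. Japan Acad. 78A (2002) Thm. 7.6);
vendored as a named fact because the CM abelian variety of a CM-arrangement (§5) and the Hodge-ring
combinatorics of §§3–4, 7 are not in the tree. The IMPLICATION is the theorem; nothing is asserted about
its hypothesis, which stays a binder of every consumer. [cite: Hazama2003GHCCM, Abstract p. 625, §1 p. 625 and Thm. 8.3 p. 655]
[cite: Hazama2002GHCCM, Thm. 7.6 p. 75] -/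
def Hazama2003_generalHodge_cmType_of_hodge_codimTwo : Prop :=
  (∀ B : Motives.AbelianVariety ℂ, CMHodgeCodimTwoHypothesisAt B) →
    ∀ A : Motives.AbelianVariety ℂ, CMGeneralHodgeHypothesisAt A

/-! ### Edges (proved, modulo the record where it is named) -/

/-- **`HC_CM` in codimension two ⟹ `GHC_CM`**, the named fact applied. [cite: Hazama2003GHCCM, Thm. 8.3 p. 655] -/
theorem cmGeneralHodgeHypothesisAt_of_codimTwo
    (h83 : Hazama2003_generalHodge_cmType_of_hodge_codimTwo)
    (h2 : ∀ B : Motives.AbelianVariety ℂ, CMHodgeCodimTwoHypothesisAt B)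
    (A : Motives.AbelianVariety ℂ) : CMGeneralHodgeHypothesisAt A :=
  h83 h2 A

/-- **`HC_CM` in codimension two ⟹ `HC_CM` in every codimension** (Hazama's theorem followed by
Grothendieck 1969 p. 301, the latter unconditional in the tree: `CMGeneralHodgeHypothesisAt.cmHodgeHypothesisAt`):
granted the record, the codimension-two Hodge classes on complex CM abelian varieties carry the whole of
Milne's hypothesis (H). [cite: Hazama2003GHCCM, §1 p. 625 and Thm. 8.3 p. 655]
[cite: GrothendieckTopology1969, p. 301] -/
theorem cmHodgeHypothesisAt_of_codimTwo
    (h83 : Hazama2003_generalHodge_cmType_of_hodge_codimTwo)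
    (h2 : ∀ B : Motives.AbelianVariety ℂ, CMHodgeCodimTwoHypothesisAt B)
    (A : Motives.AbelianVariety ℂ) : Milne1999.CMHodgeHypothesisAt A :=
  (h83 h2 A).cmHodgeHypothesisAt

/-- **Granted Hazama's theorem, `HC_CM` is EQUIVALENT to its codimension-two case** (`→` unconditional,
`←` through the record and Grothendieck p. 301). Neither side is asserted.
[cite: Hazama2003GHCCM, Abstract p. 625 and Thm. 8.3 p. 655] -/
theorem cmHodgeHypothesis_iff_codimTwo (h83 : Hazama2003_generalHodge_cmType_of_hodge_codimTwo) :
    (∀ A : Motives.AbelianVariety ℂ, Milne1999.CMHodgeHypothesisAt A) ↔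
      ∀ B : Motives.AbelianVariety ℂ, CMHodgeCodimTwoHypothesisAt B :=
  ⟨fun h B ↦ (h B).codimTwo, fun h2 A ↦ cmHodgeHypothesisAt_of_codimTwo h83 h2 A⟩

/-- Hazama's record implies the Hazama–Abdulali record of `GeneralHodgePropertyCMType`
(`HC_CM ⟹ GHC_CM`): its hypothesis is weaker. [cite: Hazama2003GHCCM, Thm. 8.3 p. 655]
[cite: Abdulali2005CMHodge, Introduction] -/
theorem abdulali2005_of_hazama2003 (h83 : Hazama2003_generalHodge_cmType_of_hodge_codimTwo) :
    Abdulali2005_generalHodge_cmType_of_hodge_cmType :=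
  fun hCM A ↦ h83 (fun B ↦ (hCM B).codimTwo) A

end Literature.AlgebraicGeometry.HodgeTheory

namespace Literature.AlgebraicGeometry.Milne1999

open Literature.AlgebraicGeometry.HodgeTheory
open Literature.AlgebraicGeometry.Motives

/-- **Tate's (0.1) for every abelian variety over every finite field, from codimension-two Hodge classes on
complex CM abelian varieties**: Milne 1999 Thm. 7.1 at the intended ℓ-adic data `E` (`Theorem71 E`),
Hazama 2003 Thm. 8.3 (record) and the algebraicity of codimension-two Hodge classes on all complex abelian
varieties of CM-type. [cite: Milne1999, Thm. 7.1 p. 72] [cite: Hazama2003GHCCM, Thm. 8.3 p. 655] -/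
theorem tateAV_Fq_of_hodge_codimTwo_cmType
    {E : ∀ (k : Type) [Field k] [Finite k] (ℓ : ℕ) [Fact ℓ.Prime] [NeZero (ℓ : k)],
      GaloisWeilCohomology k ℚ_[ℓ] (padicCyclotomicCharacter k ℓ)}
    (h71 : Theorem71 E) (h83 : Hazama2003_generalHodge_cmType_of_hodge_codimTwo)
    (h2 : ∀ B : AbelianVariety ℂ, CMHodgeCodimTwoHypothesisAt B) : TateStatement01 E :=
  tateAV_Fq_of_HC_CM h71 fun A ↦ cmHodgeHypothesisAt_of_codimTwo h83 h2 A

end Literature.AlgebraicGeometry.Milne1999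

end
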